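import Summits.CriticalPhenomena.PercolationContinuityZ3.Theorems.PercNearOneGluingNoHeavyQuantBlockCombRootGateAffine
import Summits.CriticalPhenomena.PercolationContinuityZ3.Theorems.PercNearOneGluingNoHeavyQuantBlockCombMarkovMerge
import HarnessLib

/-!
# QUANT lane R8, FAR on trees: the far-relay row for EVERY block-comb (canonical model, every depth, mean hypothesis only)

builds on p205010 (kernel theorem, internal audit signed; external expert review pending)

Support file (`--supports stmt-CriticalPhenomena-4575`), QUANT lane seat prim-quant-census-1 (gen 13); memo
`run/shared/lean/prim/quant/prim-quant-census-1/GENERAL-ROW-G13.md`.  Theorems only (local notation, no definitions), no sorries,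
standard axioms.  Model and notation: `…QuantBlockCombMergeModel.lean` (chain gates `q`, levels `lv`, sizes `a`, private gates `g`,
explicit tail `TAIL = P(N ≥ j+1)`; root level `0`; the marginal of blob `k` is `(∏_{i<lv k} q i)·g k`).  Third of three files;
tools: `tail_ge_of_rootGate_le`, `tail_append_gate` (`…RootGateAffine`), `tail_ge_mean_markov`, `merge_tied_root` (`…MarkovMerge`),
p1 g8's `tail_ge_marg_of_giant`, lead g12's `tail_ge_of_class`, lead g13's root split `tail_succ_ge_rootGate_mul` /
`sum_marg_le_contracted`.

* `Quant.BlockComb.tail_ge_of_mean` — **THEOREM (the far-relay row for every block-comb).**  Chain of `D` gates in `[0,1]` with floor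
  `x = ∏_{i<D} q i > 0`; blobs with live levels `≤ D`, sizes `a k`, private gates in `[0,1]`, every live marginal `≥ x`; budget
  `2j < Σ_k a k·marginal k` (`= EN`).  Then `x ≤ TAIL = P(N ≥ j+1)`.  No class / strong / tied / root-mass / common-gate hypothesis:
  the block-comb row of `Quant.FarRelayRow` at every layer, budget-binding regime included (it contains every earlier block-comb
  family of the lane: block-stars, combs, the class, the strong regime, tied-plus-one, hub + root blocks).
  PROOF (induction on `#live blobs + D`): (i) `(Σ a)·x > 2j` → `tail_ge_of_class` (covers `x = 1`); (ii) a giant →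
  `tail_ge_marg_of_giant`; (iii) MARKOV REGIME `x·(Σ a − j) ≤ j` → `tail_ge_mean_markov`; (iv) a live TIED root blob `τ`: outside
  (ii)(iii) it is always mergeable (`j < x(Σ a − j) ≤ x(Σ a − a τ)`) → `merge_tied_root` and the induction hypothesis; (v) every live
  root gate `≥ x/q 0` (in particular no live root blob) → root split + induction hypothesis one level down; (vi) otherwise the least
  live root gate `g s ∈ (x, x/q 0)`: RAISE the first gate to `t = q 0·g s/x ∈ (q 0, 1)` — every marginal only grows, the floor becomes
  `g s`, `s` is tied and (by (iv)'s inequality at the larger floor) mergeable; the induction hypothesis for the merged raised instance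
  and `tail_ge_of_rootGate_le` carry `g s ≤ TAIL[q 0 := t]` back to `x ≤ TAIL[q]`.  The N24 (9) corner of LEAD-NOTES-G13 (two root
  carriers, `g₀g₁ < x ≤ g₀ < x/q 0`) is case (vi).  Exact certificate of the whole case tree (every inequality in rational arithmetic,
  incl. the affine identity and the merge monotonicity) on 650 budget-binding / corner instances: census-1 g13 `lab/cert.py`.
* `Quant.BlockComb.prefixProd_le_tail_of_mean` — the same with `x` spelled `∏_{i<D} q i`.
* `Quant.BlockComb.tail_ge_of_mean_le` — the same for ANY floor `0 < x ≤ ∏_{i<D} q i` below every live marginal (append the virtual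
  gate `x/∏ q` below the deepest level: `tail_append_gate`).
-/

namespace Summit.CriticalPhenomena.PercolationContinuityZ3.Theorems

namespace Quant

namespace BlockComb

open Finset

variable {κ : Type*} [Fintype κ] [DecidableEq κ]

/-- product-Bernoulli weight of the set `S` of open blob gates -/
local notation3 "wt[" g ", " S "]" => ∏ k, (if k ∈ (S : Finset κ) then (g : κ → ℝ) k else 1 - (g : κ → ℝ) k)

/-- probability that the chain `q` of length `D` is open exactly to depth `i` -/
local notation3 "pd[" D ", " q ", " i "]" =>
  (∏ i' ∈ Finset.range (i : ℕ), (q : ℕ → ℝ) i') * (if (i : ℕ) < (D : ℕ) then 1 - (q : ℕ → ℝ) i else 1)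

/-- mass counted at depth `i` in blob configuration `S` -/
local notation3 "mass[" lv ", " a ", " i ", " S "]" =>
  ∑ k ∈ (S : Finset κ).filter (fun k => (lv : κ → ℕ) k ≤ (i : ℕ)), ((a : κ → ℕ) k : ℕ)

/-- the tail `P(N ≥ j+1)` of the block-comb count, as an explicit finite sum -/
local notation3 "TAIL[" D ", " q ", " lv ", " a ", " g ", " j "]" =>
  ∑ i ∈ Finset.range ((D : ℕ) + 1), pd[D, q, i] *
    ∑ S : Finset κ, wt[g, S] * (if (j : ℕ) + 1 ≤ mass[lv, a, i, S] then (1 : ℝ) else 0)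

/-! ### The far-relay row for every block-comb -/

/-- The induction behind `tail_ge_of_mean` (on `#live blobs + D`). [this work] -/
theorem tail_ge_of_mean_aux : ∀ (M : ℕ) (D : ℕ) (q : ℕ → ℝ), (∀ i, 0 ≤ q i ∧ q i ≤ 1) →
    ∀ (lv : κ → ℕ) (a : κ → ℕ) (g : κ → ℝ), (∀ k, 0 ≤ g k ∧ g k ≤ 1) → ∀ (j : ℕ),
    (∀ k, 0 < a k → lv k ≤ D) →
    ∀ (x : ℝ), 0 < x → x = ∏ i ∈ Finset.range D, q i →
    (∀ k, 0 < a k → x ≤ (∏ i ∈ Finset.range (lv k), q i) * g k) →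
    (2 * j : ℝ) < ∑ k, (a k : ℝ) * ((∏ i ∈ Finset.range (lv k), q i) * g k) →
    (Finset.univ.filter (fun k => 0 < a k)).card + D ≤ M →
    x ≤ TAIL[D, q, lv, a, g, j] := by
  intro M
  induction M with
  | zero =>
    intro D q hq lv a g hg j hlv x hx0 hxq hmarg hbudget hM
    -- no live blob: the budget `0 > 2j ≥ 0` is absurd
    have hcard : (Finset.univ.filter (fun k => 0 < a k)).card = 0 := by omega
    have hnone : ∀ k, a k = 0 := by
      intro k
      by_contra hk
      have : k ∈ Finset.univ.filter (fun k => 0 < a k) := Finset.mem_filter.2 ⟨Finset.mem_univ _, Nat.pos_of_ne_zero hk⟩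
      rw [Finset.card_eq_zero.1 hcard] at this
      exact absurd this (Finset.notMem_empty _)
    have h0 : ∑ k, (a k : ℝ) * ((∏ i ∈ Finset.range (lv k), q i) * g k) = 0 :=
      Finset.sum_eq_zero fun k _ => by rw [hnone k]; simp
    have : (0 : ℝ) ≤ 2 * j := by positivity
    linarith
  | succ M ih =>
    intro D q hq lv a g hg j hlv x hx0 hxq hmarg hbudget hM
    -- some blob is live
    have hne : ∃ k, 0 < a k := by
      by_contra hnone
      push Not at hnone
      have h0 : ∑ k, (a k : ℝ) * ((∏ i ∈ Finset.range (lv k), q i) * g k) = 0 := by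
        refine Finset.sum_eq_zero fun k _ => ?_
        have hk : a k = 0 := by have := hnone k; omega
        rw [hk]; simp
      have : (0 : ℝ) ≤ 2 * j := by positivity
      linarith
    -- total size `n ≥ EN > 2j`
    set n : ℝ := ∑ k, (a k : ℝ) with hn
    have hn0 : 0 ≤ n := Finset.sum_nonneg fun k _ => Nat.cast_nonneg _
    have hm1 : ∀ k, (∏ i ∈ Finset.range (lv k), q i) * g k ≤ 1 := fun k =>
      mul_le_one₀ (prefixProd_mem q hq _).2 (hg k).1 (hg k).2
    have hENle : ∑ k, (a k : ℝ) * ((∏ i ∈ Finset.range (lv k), q i) * g k) ≤ n :=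
      Finset.sum_le_sum fun k _ => mul_le_of_le_one_right (Nat.cast_nonneg _) (hm1 k)
    have hjn : (j : ℝ) < n := by
      have : (0 : ℝ) ≤ j := Nat.cast_nonneg _
      linarith
    -- (i) the class regime (covers `x = 1`)
    by_cases hclass : (2 * j : ℝ) < n * x
    · exact tail_ge_of_class D q hq lv a g hg j hlv x hmarg hclass hne
    push Not at hclass
    have hx1 : x < 1 := by
      by_contra h
      push Not at h
      have : n * 1 ≤ n * x := mul_le_mul_of_nonneg_left h hn0
      linarith
    -- (ii) a giant blob
    by_cases hgiant : ∃ k, 0 < a k ∧ j + 1 ≤ a k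
    · obtain ⟨k, hk, hkj⟩ := hgiant
      exact (hmarg k hk).trans (tail_ge_marg_of_giant D q hq lv a g hg j k hkj (hlv k hk))
    push Not at hgiant
    have hsmall : ∀ k, (a k : ℝ) ≤ j := by
      intro k
      by_cases hk : 0 < a k
      · exact_mod_cast Nat.lt_succ_iff.1 (hgiant k hk)
      · have : a k = 0 := by omega
        rw [this]; exact_mod_cast Nat.zero_le j
    -- (iii) the Markov regime
    by_cases hmk : x * (n - j) ≤ j
    · refine le_trans ?_ (tail_ge_mean_markov D q hq lv a g hg j hlv hjn)
      rw [le_div_iff₀ (sub_pos.2 hjn)]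
      linarith
    push Not at hmk
    -- (iv) a live TIED root blob: merge it (it is mergeable outside the Markov regime)
    by_cases htied : ∃ τ, 0 < a τ ∧ lv τ = 0 ∧ g τ = x
    · obtain ⟨τ, hτ, hτ0, hgτ⟩ := htied
      have hMτ : (j : ℝ) ≤ x * (n - a τ) := by
        have h1 : x * (n - j) ≤ x * (n - a τ) := mul_le_mul_of_nonneg_left (by linarith [hsmall τ]) hx0.le
        linarith
      obtain ⟨aT, hlive, hcardT, hmeanT, hle⟩ :=
        merge_tied_root D q hq lv a g hg j x hmarg τ hτ hτ0 hgτ hMτ (by linarith [hsmall τ])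
      have hMT : (Finset.univ.filter (fun k => 0 < aT k)).card + D ≤ M := by omega
      exact (ih D q hq lv aT g hg j (fun k hk => hlv k (hlive k hk)) x hx0 hxq (fun k hk => hmarg k (hlive k hk))
        (hbudget.trans_le hmeanT) hMT).trans hle
    push Not at htied
    -- every live root blob is strictly more reliable than the floor
    have hrootgt : ∀ k, 0 < a k → lv k = 0 → x < g k := by
      intro k hk hk0
      have h := hmarg k hk
      rw [hk0, Finset.prod_range_zero, one_mul] at h
      exact lt_of_le_of_ne h (fun h' => htied k hk hk0 h'.symm)
    -- `D ≥ 1`: at `D = 0` the floor is `1`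
    obtain ⟨D', rfl⟩ : ∃ D', D = D' + 1 := by
      cases D with
      | zero =>
        exfalso
        rw [Finset.prod_range_zero] at hxq
        linarith
      | succ D' => exact ⟨D', rfl⟩
    have hq0 : 0 < q 0 := by
      rcases (hq 0).1.lt_or_eq with h | h
      · exact h
      · exfalso; rw [hxq, prefixProd_succ, ← h, zero_mul] at hx0; exact lt_irrefl _ hx0
    -- the floor of the contracted instance
    have hx' : x / q 0 = ∏ i ∈ Finset.range D', q (i + 1) := by
      rw [div_eq_iff hq0.ne', hxq, prefixProd_succ, mul_comm]
    by_cases hroot : ∀ k, 0 < a k → lv k = 0 → x ≤ q 0 * g k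
    · -- (v) every live root blob stays above the contracted floor: root split, one level down
      have hlv' : ∀ k, 0 < a k → lv k - 1 ≤ D' := fun k hk => by have := hlv k hk; omega
      have hmarg' : ∀ k, 0 < a k → x / q 0 ≤ (∏ i ∈ Finset.range (lv k - 1), q (i + 1)) * g k := by
        intro k hk
        rw [div_le_iff₀ hq0]
        by_cases hk0 : lv k = 0
        · rw [hk0]
          have h := hroot k hk hk0
          simpa [mul_comm] using h
        · obtain ⟨m, hm⟩ := Nat.exists_eq_succ_of_ne_zero hk0
          have h := hmarg k hk
          rw [hm, prefixProd_succ] at h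
          rw [hm, Nat.succ_sub_one]
          linarith [h]
      have hbudget' : (2 * j : ℝ) < ∑ k, (a k : ℝ) * ((∏ i ∈ Finset.range (lv k - 1), q (i + 1)) * g k) :=
        hbudget.trans_le (sum_marg_le_contracted q hq lv a g hg)
      have hM' : (Finset.univ.filter (fun k => 0 < a k)).card + D' ≤ M := by omega
      have h := ih D' (fun i => q (i + 1)) (fun i => hq (i + 1)) (fun k => lv k - 1) a g hg j hlv'
        (x / q 0) (div_pos hx0 hq0) hx' hmarg' hbudget' hM'
      calc x = q 0 * (x / q 0) := by field_simp
        _ ≤ q 0 * TAIL[D', (fun i => q (i + 1)), (fun k => lv k - 1), a, g, j] :=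
            mul_le_mul_of_nonneg_left h (hq 0).1
        _ ≤ TAIL[D' + 1, q, lv, a, g, j] := tail_succ_ge_rootGate_mul D' q hq lv a g hg j
    · -- (vi) raise the first gate until the least reliable root blob is tied, merge it, and carry FAR back
      push Not at hroot
      obtain ⟨k₁, hk₁, hk₁0, hk₁lt⟩ := hroot
      obtain ⟨s, hsmem, hsmin⟩ := Finset.exists_min_image (Finset.univ.filter (fun k => 0 < a k ∧ lv k = 0)) g
        ⟨k₁, Finset.mem_filter.2 ⟨Finset.mem_univ _, hk₁, hk₁0⟩⟩
      obtain ⟨hs, hs0⟩ := (Finset.mem_filter.1 hsmem).2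
      have hsmin' : ∀ k, 0 < a k → lv k = 0 → g s ≤ g k := fun k hk hk0 =>
        hsmin k (Finset.mem_filter.2 ⟨Finset.mem_univ _, hk, hk0⟩)
      have hgs_lt : q 0 * g s < x :=
        lt_of_le_of_lt (mul_le_mul_of_nonneg_left (hsmin' k₁ hk₁ hk₁0) (hq 0).1) hk₁lt
      have hgs_gt : x < g s := hrootgt s hs hs0
      have hgs0 : 0 < g s := hx0.trans hgs_gt
      -- the raised first gate
      set t : ℝ := q 0 * g s / x with ht
      have ht0 : 0 < t := div_pos (mul_pos hq0 hgs0) hx0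
      have ht1 : t < 1 := by rw [ht, div_lt_one hx0]; exact hgs_lt
      have hqt : q 0 ≤ t := by
        rw [ht, le_div_iff₀ hx0]
        exact mul_le_mul_of_nonneg_left hgs_gt.le (hq 0).1
      have hq' : ∀ i, 0 ≤ Function.update q 0 t i ∧ Function.update q 0 t i ≤ 1 := by
        intro i
        by_cases hi : i = 0
        · subst hi; rw [Function.update_self]; exact ⟨ht0.le, ht1.le⟩
        · rw [Function.update_of_ne hi]; exact hq i
      -- the raised floor is `g s`
      have hxq' : g s = ∏ i ∈ Finset.range (D' + 1), Function.update q 0 t i := by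
        rw [prefixProd_update_succ, ← hx', ht]
        field_simp
      -- marginals only grow, and every live marginal is at least the new floor
      have hmarg_ge : ∀ k, (∏ i ∈ Finset.range (lv k), q i) * g k ≤
          (∏ i ∈ Finset.range (lv k), Function.update q 0 t i) * g k := by
        intro k
        refine mul_le_mul_of_nonneg_right ?_ (hg k).1
        cases hl : lv k with
        | zero => simp
        | succ m =>
          rw [prefixProd_update_succ, prefixProd_succ]
          exact mul_le_mul_of_nonneg_right hqt (Finset.prod_nonneg fun i _ => (hq (i + 1)).1)
      have hmarg_t : ∀ k, 0 < a k → g s ≤ (∏ i ∈ Finset.range (lv k), Function.update q 0 t i) * g k := by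
        intro k hk
        cases hl : lv k with
        | zero =>
          rw [Finset.prod_range_zero, one_mul]
          exact hsmin' k hk hl
        | succ m =>
          rw [prefixProd_update_succ]
          have h := hmarg k hk
          rw [hl, prefixProd_succ] at h
          have hgx : 0 ≤ g s / x := div_nonneg hgs0.le hx0.le
          calc g s = g s / x * x := by field_simp
            _ ≤ g s / x * (q 0 * (∏ i ∈ Finset.range m, q (i + 1)) * g k) := mul_le_mul_of_nonneg_left h hgx
            _ = t * (∏ i ∈ Finset.range m, q (i + 1)) * g k := by rw [ht]; ring
      have hbudget_t : (2 * j : ℝ) <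
          ∑ k, (a k : ℝ) * ((∏ i ∈ Finset.range (lv k), Function.update q 0 t i) * g k) :=
        hbudget.trans_le (Finset.sum_le_sum fun k _ => mul_le_mul_of_nonneg_left (hmarg_ge k) (Nat.cast_nonneg _))
      -- merge `s` in the raised instance (it is tied at the new floor `g s`)
      have hMs : (j : ℝ) ≤ g s * (n - a s) := by
        have h1 : x * (n - j) ≤ g s * (n - j) := mul_le_mul_of_nonneg_right hgs_gt.le (sub_pos.2 hjn).le
        have h2 : g s * (n - j) ≤ g s * (n - a s) := mul_le_mul_of_nonneg_left (by linarith [hsmall s]) hgs0.le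
        linarith
      obtain ⟨aT, hlive, hcardT, hmeanT, hle⟩ :=
        merge_tied_root (D' + 1) (Function.update q 0 t) hq' lv a g hg j (g s) hmarg_t s hs hs0 rfl hMs
          (by linarith [hsmall s])
      have hMT : (Finset.univ.filter (fun k => 0 < aT k)).card + (D' + 1) ≤ M := by omega
      have hfar_t : g s ≤ TAIL[D' + 1, Function.update q 0 t, lv, a, g, j] :=
        (ih (D' + 1) (Function.update q 0 t) hq' lv aT g hg j (fun k hk => hlv k (hlive k hk)) (g s) hgs0 hxq'
          (fun k hk => hmarg_t k (hlive k hk)) (hbudget_t.trans_le hmeanT) hMT).trans hle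
      -- carry FAR back along the first gate
      have hty : t * (g s / t) ≤ TAIL[D' + 1, Function.update q 0 t, lv, a, g, j] := by
        have : t * (g s / t) = g s := by field_simp
        rw [this]; exact hfar_t
      have hfin := tail_ge_of_rootGate_le D' q lv a g hg j (hq 0).1 t hqt ht0 (g s / t) hty
      have hxy : q 0 * (g s / t) = x := by
        rw [ht]
        field_simp
      rw [hxy] at hfin
      exact hfin

/-- **THEOREM (the far-relay row for EVERY block-comb, canonical model, every depth).**  Chain of `D` gates in `[0,1]` with floor
`x = ∏_{i<D} q i > 0`; blobs with live levels `≤ D`, sizes `a k` and private gates in `[0,1]`; every live marginal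
`(∏_{i<lv k} q i)·g k ≥ x`; budget `2j < Σ_k a k·(∏_{i<lv k} q i)·g k` (the mean of the count).  Then `x ≤ TAIL = P(N ≥ j+1)`.
This is `Quant.FarRelayRow` for every block-comb at every layer (the terminal block being a sure blob at the last level), with no
class / strong / tied / root-mass / common-gate hypothesis. [this work] -/
theorem tail_ge_of_mean (D : ℕ) (q : ℕ → ℝ) (hq : ∀ i, 0 ≤ q i ∧ q i ≤ 1) (lv : κ → ℕ) (a : κ → ℕ)
    (g : κ → ℝ) (hg : ∀ k, 0 ≤ g k ∧ g k ≤ 1) (j : ℕ) (hlv : ∀ k, 0 < a k → lv k ≤ D)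
    (x : ℝ) (hx0 : 0 < x) (hxq : x = ∏ i ∈ Finset.range D, q i)
    (hmarg : ∀ k, 0 < a k → x ≤ (∏ i ∈ Finset.range (lv k), q i) * g k)
    (hbudget : (2 * j : ℝ) < ∑ k, (a k : ℝ) * ((∏ i ∈ Finset.range (lv k), q i) * g k)) :
    x ≤ TAIL[D, q, lv, a, g, j] :=
  tail_ge_of_mean_aux _ D q hq lv a g hg j hlv x hx0 hxq hmarg hbudget le_rfl

/-- **COROLLARY (the floor as the full chain product).**  Same, concluding `∏_{i<D} q i ≤ TAIL` directly. [this work] -/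
theorem prefixProd_le_tail_of_mean (D : ℕ) (q : ℕ → ℝ) (hq : ∀ i, 0 ≤ q i ∧ q i ≤ 1) (lv : κ → ℕ) (a : κ → ℕ)
    (g : κ → ℝ) (hg : ∀ k, 0 ≤ g k ∧ g k ≤ 1) (j : ℕ) (hlv : ∀ k, 0 < a k → lv k ≤ D)
    (hx0 : 0 < ∏ i ∈ Finset.range D, q i)
    (hmarg : ∀ k, 0 < a k → ∏ i ∈ Finset.range D, q i ≤ (∏ i ∈ Finset.range (lv k), q i) * g k)
    (hbudget : (2 * j : ℝ) < ∑ k, (a k : ℝ) * ((∏ i ∈ Finset.range (lv k), q i) * g k)) :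
    ∏ i ∈ Finset.range D, q i ≤ TAIL[D, q, lv, a, g, j] :=
  tail_ge_of_mean D q hq lv a g hg j hlv _ hx0 rfl hmarg hbudget

/-- **COROLLARY (any floor up to the chain product).**  Chain of `D` gates in `[0,1]`, live levels `≤ D`; a floor `x > 0` with
`x ≤ ∏_{i<D} q i` and `x ≤` every live marginal; budget `2j < EN`.  Then `x ≤ TAIL`.  (Append the virtual gate `x/∏ q` below the
deepest level: the tail is unchanged and `x` becomes the full chain product.) [this work] -/
theorem tail_ge_of_mean_le (D : ℕ) (q : ℕ → ℝ) (hq : ∀ i, 0 ≤ q i ∧ q i ≤ 1) (lv : κ → ℕ) (a : κ → ℕ)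
    (g : κ → ℝ) (hg : ∀ k, 0 ≤ g k ∧ g k ≤ 1) (j : ℕ) (hlv : ∀ k, 0 < a k → lv k ≤ D)
    (x : ℝ) (hx0 : 0 < x) (hxle : x ≤ ∏ i ∈ Finset.range D, q i)
    (hmarg : ∀ k, 0 < a k → x ≤ (∏ i ∈ Finset.range (lv k), q i) * g k)
    (hbudget : (2 * j : ℝ) < ∑ k, (a k : ℝ) * ((∏ i ∈ Finset.range (lv k), q i) * g k)) :
    x ≤ TAIL[D, q, lv, a, g, j] := by
  set P : ℝ := ∏ i ∈ Finset.range D, q i with hP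
  have hP0 : 0 < P := hx0.trans_le hxle
  set q' : ℕ → ℝ := Function.update q D (x / P) with hq'def
  have hq' : ∀ i, 0 ≤ q' i ∧ q' i ≤ 1 := by
    intro i
    by_cases hi : i = D
    · subst hi
      rw [hq'def, Function.update_self]
      exact ⟨div_nonneg hx0.le hP0.le, (div_le_one hP0).2 hxle⟩
    · rw [hq'def, Function.update_of_ne hi]; exact hq i
  have hpre : ∀ i, i ≤ D → ∏ i' ∈ Finset.range i, q' i' = ∏ i' ∈ Finset.range i, q i' := by
    intro i hi
    refine Finset.prod_congr rfl fun i' hi' => ?_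
    have hne : i' ≠ D := by have := Finset.mem_range.1 hi'; omega
    rw [hq'def, Function.update_of_ne hne]
  have hxq' : x = ∏ i ∈ Finset.range (D + 1), q' i := by
    rw [Finset.prod_range_succ, hpre D le_rfl, hq'def, Function.update_self, ← hP]
    field_simp
  have hmarg' : ∀ k, 0 < a k → x ≤ (∏ i ∈ Finset.range (lv k), q' i) * g k := by
    intro k hk
    rw [hpre (lv k) (hlv k hk)]
    exact hmarg k hk
  have hbudget' : (2 * j : ℝ) < ∑ k, (a k : ℝ) * ((∏ i ∈ Finset.range (lv k), q' i) * g k) := by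
    refine hbudget.trans_le (le_of_eq (Finset.sum_congr rfl fun k _ => ?_))
    by_cases hk : 0 < a k
    · rw [hpre (lv k) (hlv k hk)]
    · have : a k = 0 := by omega
      rw [this]; simp
  have h := tail_ge_of_mean (D + 1) q' hq' lv a g hg j (fun k hk => (hlv k hk).trans (Nat.le_succ D)) x hx0 hxq'
    hmarg' hbudget'
  rw [hq'def, tail_append_gate D q lv a g j (x / P) hlv] at h
  exact h

end BlockComb

end Quant

end Summit.CriticalPhenomena.PercolationContinuityZ3.Theorems
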